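import Summits.QuantumFields.YangMills.Theorems.BalabanUVNodesN20StubTwoFalseOfLawSeparated
import Summits.QuantumFields.YangMills.Theorems.BalabanUVNodesN20CoreEdgeShellDialDeviationSeparation
import Summits.QuantumFields.YangMills.Theorems.BalabanUVNodesK3V6Defs

/-!
# BalabanUVNodes ∕ N20·N19′·N21 — module 13T: K3⁸'s REGISTERED STUB TEXTS (skeleton v6 b4e55110ab73e679) PREDICT LAW MERGE OF THE RECORD'S TWO ACROSS-CLASS LAWS AT EVERY
# VERSION SLOT; hence (LS) — or a PROPORTIONAL (Dev) FLOOR at ANY key map (module 13S) — cofinally along [I] Thm 2's tuned sequences at ONE live guarded SEPARATED tuple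
# carrying (B) and the endpoint at SOME revision `v` makes the TEXT of `stub_rates13HV` refute the TEXT of `stub_expansion13HV`: dag-n20-w5's v5 H-lemma (p610536) RE-ISSUED
# BY NAME at dag-n27-w1's v6 mirror `K3V6Defs`, plus its mass-currency editions and the door `v := Revision₁₃.refl`

Cell `pub-ymgap` (HUMAN RULING D-0062 Track A; D-0149 width push), seat `pub-ymgap-dag-n20-w3` (WIDTH SEAT 3 of 3 on NODE n20 = NE7b) gen 8, CLAIM-2 ∕ INTENT-2
(pub-ymgap INBOX).  Filed `--kind proof --supports stmt-QuantumFields-27366 --as helper` (K3⁸ `SpineGivenEndpointR13SepCoPHV`, route rev 28∕29; dag-lead KEY MAP v2).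
COUNT-NEUTRAL.  ADDITIVE — imports dag-n20-w5's `…N20StubTwoFalseOfLawSeparated` (p610536: `false_of_lawMerge_of_lawSeparated`, `lawMerge_at_of_pinnedFaces`; through it
dag-n19-w4's `lawMerge_of_faces` p608854, dag-n27-w1's v5 mirror `K3V5Defs` p606160, `N20AtRecord13.schemeZ_pos_datumOfRecord₁₃CoPH`), this lineage's module 13S
`…N20CoreEdgeShellDialDeviationSeparation` (`lawSeparated_record_of_frequently_fibreDevA_ge`) and dag-n27-w1's v6 mirror `K3V6Defs` (p625739: `KeyedRatesHolderD4V`,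
`KeyedCoreEdgeHolderD4V`, `KeyedExtractionV`; DEF-1's slot `Node00.Revision₁₃`, `datumOfRecord₁₃SepCoPHV`, p620607); modifies nothing.  Like p610536 ∕ 13b ∕ 13R this file sits
INSIDE the route's import cone (`K3V5Defs` imports the Theses file).  [I] = [Balaban1987RG1] (Thm 2 p.259: the tuned sequences — LOCATION only), [LF-II] = [Balaban1989LargeFieldII].

WHY.  dag-n20-w5's p610536 typed CRIT-1's H-lemma `stub2_false_of_H` (triage ed. 2, item 4) for K3⁷ v5's texts: the four faces + the rates conjunct predict LAW MERGE along
tuning at every live guarded tuple with (B)+END, so (LS) there refutes stub 2's text given stub 1's.  Route rev 28∕29 moved the crux to K3⁸ (stmt-QuantumFields-27366) and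
skeleton v6 re-keyed THREE faces at DEF-1's version slot — `KeyedRatesHolderD4V`, `KeyedCoreEdgeHolderD4V`, `KeyedExtractionV` (prefix (B)∕END∕`ForSmallCouplings`∕`PHolderD4`
read at `datumOfRecord₁₃SepCoPHV F 2 θ h v`, readings at `h.toCore`) — keeping `PinnedAtLive`, `KeyedRelWeight`, `KeyedShellWeight` verbatim.  p610536 is keyed on the ASIDE item;
its own successor note (n20-w5 g2 HANDOFF (t2)) asks for «ONE corollary file at the v6 mirror's names» — this is it, with two additions:
* §1 ★★ `lawMerge_of_keyedFacesV` — the v6 faces predict law merge `ForSmallCouplings (datumOfRecord₁₃SepCoPHV F 2 θ h v) (…)` at every guarded admissible SEPARATED tuple, EVERY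
  slot `v` with (B)(slot)+END(slot), on the live-selector line (`ForSmallCouplings.and` on the three slot-keyed faces, then p610536's `lawMerge_at_of_pinnedFaces` at `hP := h.toCore` —
  the slot datum's Wilson schemes ∕ tuning ARE the record's by DEF-1's `rfl` faces, so the v5 lemma applies VERBATIM); `totals_pos_of_pinnedExtraction` (E1∕E2 + `schemeZ_pos`: BOTH
  runs' totals positive on the window); ★★ `not_keyedFacesV_of_lawSeparated` (+ rates-bundled twin); ★★ `not_keyedFacesV_of_frequently_fibreDevA_ge` — the MASS-CURRENCY H: a
  proportional run-A (Dev) floor `s·Z_A ≤ Dev_A(kmap)` at ANY per-step key map `kmap`, frequently in `K` at some `|t| ≤ 1`, cofinally along tuning (module 13S makes it (LS) with `s∕2`;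
  positivity of the totals is DISCHARGED from the extraction face, not assumed).
* §2 at the v6 TEXTS verbatim (`K3V6Defs.spineGivenEndpointR13SepCoPHV_of_stubTextsV`'s `h₁ h₂`): ★★★ `lawMerge_of_stubTextsV` · ★★★ `stubTwoTextV_false_of_stubOneTextV_of_lawSeparated`
  · `not_stubTextsV_of_lawSeparated` · ★★ `stubTwoTextV_false_of_stubOneTextV_of_frequently_fibreDevA_ge` · §2b the EVENTUAL editions (`ForSmallCouplings.toE` at the slot datum).
* §3 THE DOOR: p610536's v5-SHAPED H at a SEPARATED tuple — (B)+END at `datumOfRecord₁₃SepCoPH F 2 θ h`, (LS) cofinal along `ForSmallCouplings (datumOfRecord₁₃SepCoPH …)` — IS the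
  v6 H at `v := Revision₁₃.refl` (`datumOfRecord₁₃SepCoPHV_refl`, `rfl`): `stubTwoTextV_false_of_stubOneTextV_of_lawSeparated_refl`.
LOCATED (said, not decided): the version slot WIDENS the disprover's door exactly as it widens the prover's obligation — H⁸ asks (B) at the separated tuple for SOME a.e.-revision of
the record's densities, not for the densities of record; the (Dev)-floor H is the first MASS-currency instance of CRIT-1's one letter at the live crux.

HONEST FRAMING.  NEGATIVE LEMMAS MODULO A HYPOTHESIS H and their positive contrapositive (law merge); H = «(LS) — or a proportional (Dev) floor at some key map — cofinally along
[I] Thm 2's tuned bare sequences, at ONE live guarded admissible Stage-13 tuple with SEPARATED provisos carrying (B) and the UV endpoint at SOME version slot» — UNDECIDED physics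
(crux card `window-key-core` N1 ∕ (XG); 13S's regime (a) vs (b)), inhabited by nobody (K0⁷ `Record13SepCoPHInhabited` OPEN), NOT asserted here.  Hence: NOT a refutation of
`stub_expansion13HV`; NOT a `Theorems/SpineGivenEndpointR13SepCoPHV/Negative/` lemma (the conclusions deny STUB TEXTS, never `SpineGivenEndpointR13SepCoPHV`, which another skeleton may
still close); proves NO estimate; nothing of Bałaban's asserted or instantiated; NE7 ∕ NE7b ∕ NE7c NOT PRINTED for d = 4, NOT proved; N19 ∕ N20 ∕ N21 NOT discharged; K3⁸ OPEN,
skeleton v6 b4e55110ab73e679 STANDS, not claimed; K3⁷ aside; counts UNMOVED; no count claim; one finite 𝕋⁴ programme at fixed ε, Bałaban AS PRINTED — R4 closes the conditional rung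
`BalabanLadder.UV` only; the YM mass gap (Clay) is NOT proved by any of this; NOT ℝ⁴, NOT OS.  No `def`, no `instance`, no `notation`, no `sorry`; [folklore] bookkeeping; no decl
carries a cite tag beyond locations.
-/

noncomputable section

open Finset
open _root_.Filter _root_.Topology

namespace Summit.QuantumFields.YangMills.BalabanUVNodes.N20StubTwoTextVFalseOfLawSeparated

open Literature.MathematicalPhysics.QuantumFieldTheory.Balaban1983to89
open Literature.MathematicalPhysics.QuantumFieldTheory.Balaban1983to89.T4WeightBudget (RelWeightBound)
open Literature.MathematicalPhysics.QuantumFieldTheory.Balaban1983to89.T4IndicatorShell (ShellWeightBound)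
open Literature.MathematicalPhysics.QuantumFieldTheory.Balaban1983to89.T4Continuum
open Literature.MathematicalPhysics.QuantumFieldTheory.Balaban1983to89.Node00
open T4ContinuumYM4Torus (ForSmallCouplings)
open Summit.QuantumFields.BalabanUV.T4Continuum.Spine.NE7 (Core)
open YMDAG.UVSplit
open Summit.QuantumFields.YangMills.Theorems.K3V5Defs
open Summit.QuantumFields.YangMills.Theorems.K3V6Defs (KeyedRatesHolderD4V KeyedCoreEdgeHolderD4V KeyedExtractionV)
open Summit.QuantumFields.YangMills.Theorems.N20AtRecord13 (schemeZ_pos_datumOfRecord₁₃CoPH)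
open Summit.QuantumFields.YangMills.BalabanUVNodes.N20StubTwoFalseOfLawSeparated (false_of_lawMerge_of_lawSeparated lawMerge_at_of_pinnedFaces)
open Summit.QuantumFields.YangMills.BalabanUVNodes.N20CoreEdgeShellDialDeviationSeparation (lawSeparated_record_of_frequently_fibreDevA_ge)

variable {F : T4Family}

/-! ## §1 At a spine reading PINNED AT LIVE (`N = 2`, offset `0`): the v6 faces ⇒ law merge along tuning AT EVERY SLOT; (LS) ∕ a proportional (Dev) floor ⇒ no faces -/

section AtThePin

/-- **BOTH RUNS' TOTALS ARE POSITIVE ON THE WINDOW AT A PINNED READING CARRYING THE EXTRACTION ROWS** [bookkeeping]: on the live-selector line the pin makes the carriers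
dag-n20-d's `crOfRecord₁₃VAt 0 (jc …) sh` (`l₀ ∕ K₀ ∕ T ∕ A ∕ B = 1 ∕ 0 ∕ classSet₁₃ ∕ weightA₁₃ ∕ weightB₁₃` by `rfl`); the rows E1 ∕ E2 say the class sums ARE the dressed partition
functions `schemeZ` of the datum of record after `K` ∕ `K + 1` steps, positive by `schemeZ_pos_datumOfRecord₁₃CoPH`. -/
theorem totals_pos_of_pinnedExtraction (jc : CutReading) (sh : ShellSplit₁₃CoPH 2 0) (cr : SpineReading) (hpin : PinnedAtLive jc sh cr)
    (θ : Stage13HParams F 2) (hP : θ.Provisos₁₃CoPH F 2) (g₀ : ℕ → ℝ) (os : List (ULoop F)) (hlive : LiveSel F θ)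
    (hE1 : ∀ (K : ℕ) (t : ℝ), |t| ≤ (cr F θ hP g₀ os).l₀ →
      T4GenFunBounds.schemeZ ((datumOfRecord₁₃CoPH F 2 θ hP).scheme g₀) os ((cr F θ hP g₀ os).K₀ + K) t = ∑ τ ∈ (cr F θ hP g₀ os).T K, (cr F θ hP g₀ os).A K t τ)
    (hE2 : ∀ (K : ℕ) (t : ℝ), |t| ≤ (cr F θ hP g₀ os).l₀ →
      T4GenFunBounds.schemeZ ((datumOfRecord₁₃CoPH F 2 θ hP).scheme g₀) os ((cr F θ hP g₀ os).K₀ + K + 1) t = ∑ τ ∈ (cr F θ hP g₀ os).T K, (cr F θ hP g₀ os).B K t τ)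
    (K : ℕ) (t : ℝ) (ht : |t| ≤ 1) :
    0 < ∑ x ∈ classSet₁₃ θ 0 g₀ K, weightA₁₃ θ hP 0 g₀ os K t x ∧ 0 < ∑ x ∈ classSet₁₃ θ 0 g₀ K, weightB₁₃ θ hP 0 g₀ os K t x := by
  have e : cr F θ hP g₀ os = crOfRecord₁₃VAt 0 (jc F θ hP g₀ os) sh F θ hP g₀ os := hpin F θ hP g₀ os hlive
  rw [e] at hE1 hE2
  have hA := schemeZ_pos_datumOfRecord₁₃CoPH θ hP g₀ os ((crOfRecord₁₃VAt 0 (jc F θ hP g₀ os) sh F θ hP g₀ os).K₀ + K) t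
  have hB := schemeZ_pos_datumOfRecord₁₃CoPH θ hP g₀ os ((crOfRecord₁₃VAt 0 (jc F θ hP g₀ os) sh F θ hP g₀ os).K₀ + K + 1) t
  rw [hE1 K t ht] at hA
  rw [hE2 K t ht] at hB
  exact ⟨hA, hB⟩

/-- ★★ **THE v6 FACES AND THE v6 RATES CONJUNCT PREDICT LAW MERGE ALONG TUNING, AT EVERY VERSION SLOT.**  For ANY exponent `β`, rate reading `rr`, witness `(jc, sh, cr)` pinned at
live: if `KeyedRatesHolderD4V β rr` (stub 1's rates conjunct, v6) and the four v6 faces `KeyedRelWeight cr ∧ KeyedShellWeight cr ∧ KeyedExtractionV cr ∧ KeyedCoreEdgeHolderD4V β cr rr`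
(stub 2's conclusion) hold, then at every Stage-13 tuple `(F, θ, h)` with SEPARATED provisos passing the guard, admissible, on the live-selector line, and EVERY slot
`v : Revision₁₃ F 2 θ h` carrying (B) and the endpoint at the slot datum: along EVERY tuned bare sequence of [I] Thm 2's window of the SLOT datum, for every loop string, every
`s > 0`, all large `K`, every `|t| ≤ 1` and every `S ⊆ classSet₁₃ θ 0 g₀ K`, `|μ_B(S) − μ_A(S)| < s` at the core provisos `h.toCore`.  Proof: `ForSmallCouplings.and` on the three
slot-keyed faces; the slot datum's schemes are the record's (DEF-1's `rfl` faces), so p610536's `lawMerge_at_of_pinnedFaces` applies verbatim. [bookkeeping] -/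
theorem lawMerge_of_keyedFacesV (β : ℝ) (rr : RateReadingFn) (jc : CutReading) (sh : ShellSplit₁₃CoPH 2 0) (cr : SpineReading)
    (hrates : KeyedRatesHolderD4V β rr) (hpin : PinnedAtLive jc sh cr)
    (h20 : KeyedRelWeight cr) (h21 : KeyedShellWeight cr) (hx : KeyedExtractionV cr) (h19 : KeyedCoreEdgeHolderD4V β cr rr)
    (θ : Stage13HParams F 2) (h : θ.Provisos₁₃SepCoPH F 2) (v : Revision₁₃ F 2 θ h) (hG : θ.ZhUnity F 2 ∧ θ.SlotsNondegenerate₁₃ F 2) (hθ : θ.Admissible F 2)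
    (hB : B16.EndStatementBPrinted (datumOfRecord₁₃SepCoPHV F 2 θ h v).C) (hE : DagBinding.EndpointExistence (datumOfRecord₁₃SepCoPHV F 2 θ h v).C.toB12)
    (hlive : LiveSel F θ) :
    ForSmallCouplings (datumOfRecord₁₃SepCoPHV F 2 θ h v) fun g₀ => ∀ (os : List (ULoop F)) (s : ℝ), 0 < s →
      ∀ᶠ K in atTop, ∀ t : ℝ, |t| ≤ 1 → ∀ S, S ⊆ classSet₁₃ θ 0 g₀ K →
        |(∑ x ∈ S, weightB₁₃ θ h.toCore 0 g₀ os K t x) / (∑ x ∈ classSet₁₃ θ 0 g₀ K, weightB₁₃ θ h.toCore 0 g₀ os K t x) -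
            (∑ x ∈ S, weightA₁₃ θ h.toCore 0 g₀ os K t x) / (∑ x ∈ classSet₁₃ θ 0 g₀ K, weightA₁₃ θ h.toCore 0 g₀ os K t x)| < s := by
  refine (((hrates F θ h v hG hθ hB hE).and (h19 F θ h v hG hθ hB hE)).and (hx F θ h v hG hθ hB hE)).mono fun g₀ hg os s hs => ?_
  obtain ⟨⟨hR, hcore⟩, hX⟩ := hg
  exact lawMerge_at_of_pinnedFaces jc sh cr hpin θ h.toCore g₀ os hlive (h20 F θ h.toCore hG hθ g₀ os) (h21 F θ h.toCore hG hθ g₀ os) (hcore os (hR os))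
    (hX os).2.2.1 hs

/-- ★★ **THE H-LEMMA AT THE v6 FACES: (LS) COFINAL IN THE SLOT DATUM's WINDOW ⇒ NO PINNED WITNESS.**  If at ONE guarded admissible separated tuple on the live-selector line, at SOME
slot `v` with (B) and the endpoint, the record's laws are `s`-separated for some `s > 0` (dag-n19-w4's dial-free `hsep` at `h.toCore`) NOT eventually excluded along tuning —
`¬ ForSmallCouplings (datumOfRecord₁₃SepCoPHV F 2 θ h v) (g₀ ↦ ∀ os s, 0 < s → ¬ hsep)` — then for every `β`, every `rr` with `KeyedRatesHolderD4V β rr` and every `(jc, sh, cr)`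
with `PinnedAtLive jc sh cr`: `¬ (KeyedRelWeight cr ∧ KeyedShellWeight cr ∧ KeyedExtractionV cr ∧ KeyedCoreEdgeHolderD4V β cr rr)`.  H is DISPLAYED, not asserted. [bookkeeping] -/
theorem not_keyedFacesV_of_lawSeparated (β : ℝ) (rr : RateReadingFn) (jc : CutReading) (sh : ShellSplit₁₃CoPH 2 0) (cr : SpineReading)
    (hrates : KeyedRatesHolderD4V β rr) (hpin : PinnedAtLive jc sh cr)
    (θ : Stage13HParams F 2) (h : θ.Provisos₁₃SepCoPH F 2) (v : Revision₁₃ F 2 θ h) (hG : θ.ZhUnity F 2 ∧ θ.SlotsNondegenerate₁₃ F 2) (hθ : θ.Admissible F 2)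
    (hB : B16.EndStatementBPrinted (datumOfRecord₁₃SepCoPHV F 2 θ h v).C) (hE : DagBinding.EndpointExistence (datumOfRecord₁₃SepCoPHV F 2 θ h v).C.toB12)
    (hlive : LiveSel F θ)
    (hLS : ¬ ForSmallCouplings (datumOfRecord₁₃SepCoPHV F 2 θ h v) fun g₀ => ∀ (os : List (ULoop F)) (s : ℝ), 0 < s →
      ¬ ∀ K₁ : ℕ, ∃ K, K₁ ≤ K ∧ ∃ t : ℝ, |t| ≤ 1 ∧ ∃ S, S ⊆ classSet₁₃ θ 0 g₀ K ∧
        s ≤ (∑ x ∈ S, weightB₁₃ θ h.toCore 0 g₀ os K t x) / (∑ x ∈ classSet₁₃ θ 0 g₀ K, weightB₁₃ θ h.toCore 0 g₀ os K t x) -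
            (∑ x ∈ S, weightA₁₃ θ h.toCore 0 g₀ os K t x) / (∑ x ∈ classSet₁₃ θ 0 g₀ K, weightA₁₃ θ h.toCore 0 g₀ os K t x)) :
    ¬ (KeyedRelWeight cr ∧ KeyedShellWeight cr ∧ KeyedExtractionV cr ∧ KeyedCoreEdgeHolderD4V β cr rr) := by
  rintro ⟨h20, h21, hx, h19⟩
  exact hLS ((lawMerge_of_keyedFacesV β rr jc sh cr hrates hpin h20 h21 hx h19 θ h v hG hθ hB hE hlive).mono fun g₀ hg os s hs hsep =>
    false_of_lawMerge_of_lawSeparated 0 θ h.toCore g₀ os (hg os s hs) hsep)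

/-- **RATES-BUNDLED TWIN** [bookkeeping]: if at one such tuple and slot `¬ ForSmallCouplings D_v (g₀ ↦ ∀ os, PHolderD4 β D_v (rr …) → ∀ s > 0, ¬ hsep)` — cofinally some tuned `g₀`, `os`
carry the rates TOGETHER WITH an `s`-separation — then no pinned witness carries the four v6 faces for this `β`, `rr` (no separate rates conjunct). -/
theorem not_keyedFacesV_of_ratesWithLawSeparated (β : ℝ) (rr : RateReadingFn) (jc : CutReading) (sh : ShellSplit₁₃CoPH 2 0) (cr : SpineReading)
    (hpin : PinnedAtLive jc sh cr)
    (θ : Stage13HParams F 2) (h : θ.Provisos₁₃SepCoPH F 2) (v : Revision₁₃ F 2 θ h) (hG : θ.ZhUnity F 2 ∧ θ.SlotsNondegenerate₁₃ F 2) (hθ : θ.Admissible F 2)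
    (hB : B16.EndStatementBPrinted (datumOfRecord₁₃SepCoPHV F 2 θ h v).C) (hE : DagBinding.EndpointExistence (datumOfRecord₁₃SepCoPHV F 2 θ h v).C.toB12)
    (hlive : LiveSel F θ)
    (hLS : ¬ ForSmallCouplings (datumOfRecord₁₃SepCoPHV F 2 θ h v) fun g₀ => ∀ os : List (ULoop F),
      PHolderD4 β (datumOfRecord₁₃SepCoPHV F 2 θ h v) (rr F θ h.toCore g₀ os) → ∀ s : ℝ, 0 < s →
        ¬ ∀ K₁ : ℕ, ∃ K, K₁ ≤ K ∧ ∃ t : ℝ, |t| ≤ 1 ∧ ∃ S, S ⊆ classSet₁₃ θ 0 g₀ K ∧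
          s ≤ (∑ x ∈ S, weightB₁₃ θ h.toCore 0 g₀ os K t x) / (∑ x ∈ classSet₁₃ θ 0 g₀ K, weightB₁₃ θ h.toCore 0 g₀ os K t x) -
              (∑ x ∈ S, weightA₁₃ θ h.toCore 0 g₀ os K t x) / (∑ x ∈ classSet₁₃ θ 0 g₀ K, weightA₁₃ θ h.toCore 0 g₀ os K t x)) :
    ¬ (KeyedRelWeight cr ∧ KeyedShellWeight cr ∧ KeyedExtractionV cr ∧ KeyedCoreEdgeHolderD4V β cr rr) := by
  rintro ⟨h20, h21, hx, h19⟩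
  refine hLS (((h19 F θ h v hG hθ hB hE).and (hx F θ h v hG hθ hB hE)).mono fun g₀ hg os hP4 s hs hsep => ?_)
  obtain ⟨hcore, hX⟩ := hg
  exact false_of_lawMerge_of_lawSeparated 0 θ h.toCore g₀ os
    (lawMerge_at_of_pinnedFaces jc sh cr hpin θ h.toCore g₀ os hlive (h20 F θ h.toCore hG hθ g₀ os) (h21 F θ h.toCore hG hθ g₀ os) (hcore os hP4)
      (hX os).2.2.1 hs) hsep

/-- ★★ **THE MASS-CURRENCY H-LEMMA AT THE v6 FACES: A PROPORTIONAL run-A (Dev) FLOOR COFINAL IN THE WINDOW ⇒ NO PINNED WITNESS.**  If at ONE guarded admissible separated tuple on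
the live-selector line, at SOME slot `v` with (B) and the endpoint, the following is NOT eventually excluded along the slot datum's tuning: «for some loop string, some `s > 0` and
some per-step key map `kmap`, module 13L's run-A deviation of the record's class weights at `kmap` is `≥ s·Σ weightA₁₃` for infinitely many `K` at some `|t| ≤ 1`» — then no pinned
witness carries the four v6 faces (for any `β`, any `rr` with the v6 rates conjunct).  The floor IS law separation with `s∕2` (module 13S) once BOTH totals are positive — and they
are, by the witness's own extraction rows (`totals_pos_of_pinnedExtraction`); the floor is a HYPOTHESIS on Bałaban's two-run weights, measured by nobody. [bookkeeping] -/
theorem not_keyedFacesV_of_frequently_fibreDevA_ge (β : ℝ) (rr : RateReadingFn) (jc : CutReading) (sh : ShellSplit₁₃CoPH 2 0) (cr : SpineReading)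
    (hrates : KeyedRatesHolderD4V β rr) (hpin : PinnedAtLive jc sh cr)
    (θ : Stage13HParams F 2) (h : θ.Provisos₁₃SepCoPH F 2) (v : Revision₁₃ F 2 θ h) (hG : θ.ZhUnity F 2 ∧ θ.SlotsNondegenerate₁₃ F 2) (hθ : θ.Admissible F 2)
    (hB : B16.EndStatementBPrinted (datumOfRecord₁₃SepCoPHV F 2 θ h v).C) (hE : DagBinding.EndpointExistence (datumOfRecord₁₃SepCoPHV F 2 θ h v).C.toB12)
    (hlive : LiveSel F θ)
    (hDev : ¬ ForSmallCouplings (datumOfRecord₁₃SepCoPHV F 2 θ h v) fun g₀ => ∀ (os : List (ULoop F)) (s : ℝ), 0 < s →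
      ∀ kmap : ℕ → (Σ K, SiteSeqKey F (0 + K)) → (Σ K, SiteSeqKey F (0 + K)),
        ¬ ∀ K₁ : ℕ, ∃ K, K₁ ≤ K ∧ ∃ t : ℝ, |t| ≤ 1 ∧
          s * ∑ x ∈ classSet₁₃ θ 0 g₀ K, weightA₁₃ θ h.toCore 0 g₀ os K t x ≤
            ∑ x ∈ classSet₁₃ θ 0 g₀ K, max 0 (weightA₁₃ θ h.toCore 0 g₀ os K t x -
              weightAK₁₃ θ h.toCore 0 g₀ os kmap K t (kmap K x) / weightBK₁₃ θ h.toCore 0 g₀ os kmap K t (kmap K x) * weightB₁₃ θ h.toCore 0 g₀ os K t x)) :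
    ¬ (KeyedRelWeight cr ∧ KeyedShellWeight cr ∧ KeyedExtractionV cr ∧ KeyedCoreEdgeHolderD4V β cr rr) := by
  rintro ⟨h20, h21, hx, h19⟩
  refine hDev (((lawMerge_of_keyedFacesV β rr jc sh cr hrates hpin h20 h21 hx h19 θ h v hG hθ hB hE hlive).and (hx F θ h v hG hθ hB hE)).mono
    fun g₀ hg os s hs kmap hfloor => ?_)
  obtain ⟨hmerge, hX⟩ := hg
  have hpos := totals_pos_of_pinnedExtraction jc sh cr hpin θ h.toCore g₀ os hlive (hX os).2.2.1 (hX os).2.2.2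
  refine false_of_lawMerge_of_lawSeparated 0 θ h.toCore g₀ os (hmerge os (s / 2) (by linarith))
    (lawSeparated_record_of_frequently_fibreDevA_ge 0 θ h.toCore g₀ os kmap fun K₁ => ?_)
  obtain ⟨K, hK, t, ht, hle⟩ := hfloor K₁
  exact ⟨K, hK, t, ht, (hpos K t ht).1, (hpos K t ht).2, hle⟩

end AtThePin

/-! ## §2 At the two REGISTERED STUB TEXTS of K3⁸ v6 (b4e55110ab73e679), BY NAME over `K3V6Defs`: the prediction, and the H-lemmas -/

section AtTheTexts

/-- ★★★ **WHAT THE v6 SKELETON PREDICTS AT THE RECORD: LAW MERGE ALONG TUNING AT EVERY SLOT.**  If the TEXT of `stub_rates13HV` (left) and the TEXT of `stub_expansion13HV` (right)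
both hold — the texts VERBATIM over the mirrored names, as in `K3V6Defs.spineGivenEndpointR13SepCoPHV_of_stubTextsV` — then at every Stage-13 tuple with separated provisos passing
`ZhUnity ∧ SlotsNondegenerate₁₃`, `Admissible`, on the live-selector line, and every version slot `v` carrying (B) and the UV endpoint at the slot datum: along every tuned bare
sequence of [I] Thm 2's window the two across-class laws of `(classSet₁₃ θ 0 g₀, weightA₁₃, weightB₁₃)` (at `h.toCore`) MERGE.  A TESTABLE consequence of the skeleton AS CUT, at
dial-free letters.  NOT a proof of either stub. [bookkeeping] -/
theorem lawMerge_of_stubTextsV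
    (h₁ : ∃ β : ℝ, 2 / 3 < β ∧ β < 1 ∧ ∃ (𝔯 : RateReading₁₃CoPH 2) (ksel : RunSel) (ℓ : LetterReading) (ℓ₃ : T4Family → Node00.NE3Letters₁₁) (g B : T4Family → ℝ),
      GuardedReadingN16 𝔯 ksel ℓ ℓ₃ g B ∧ KeyedRatesHolderD4V β (rrOfRecord 𝔯 ksel))
    (h₂ : ∀ β : ℝ, 2 / 3 < β → β < 1 → ∀ (𝔯 : RateReading₁₃CoPH 2) (ksel : RunSel) (ℓ : LetterReading) (ℓ₃ : T4Family → Node00.NE3Letters₁₁) (g B : T4Family → ℝ),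
      GuardedReadingN16 𝔯 ksel ℓ ℓ₃ g B → KeyedRatesHolderD4V β (rrOfRecord 𝔯 ksel) →
      ∃ (jc : CutReading) (sh : ShellSplit₁₃CoPH 2 0) (cr : SpineReading), PinnedAtLive jc sh cr ∧
        KeyedRelWeight cr ∧ KeyedShellWeight cr ∧ KeyedExtractionV cr ∧ KeyedCoreEdgeHolderD4V β cr (rrOfRecord 𝔯 ksel))
    (θ : Stage13HParams F 2) (h : θ.Provisos₁₃SepCoPH F 2) (v : Revision₁₃ F 2 θ h) (hG : θ.ZhUnity F 2 ∧ θ.SlotsNondegenerate₁₃ F 2) (hθ : θ.Admissible F 2)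
    (hB : B16.EndStatementBPrinted (datumOfRecord₁₃SepCoPHV F 2 θ h v).C) (hE : DagBinding.EndpointExistence (datumOfRecord₁₃SepCoPHV F 2 θ h v).C.toB12)
    (hlive : LiveSel F θ) :
    ForSmallCouplings (datumOfRecord₁₃SepCoPHV F 2 θ h v) fun g₀ => ∀ (os : List (ULoop F)) (s : ℝ), 0 < s →
      ∀ᶠ K in atTop, ∀ t : ℝ, |t| ≤ 1 → ∀ S, S ⊆ classSet₁₃ θ 0 g₀ K →
        |(∑ x ∈ S, weightB₁₃ θ h.toCore 0 g₀ os K t x) / (∑ x ∈ classSet₁₃ θ 0 g₀ K, weightB₁₃ θ h.toCore 0 g₀ os K t x) -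
            (∑ x ∈ S, weightA₁₃ θ h.toCore 0 g₀ os K t x) / (∑ x ∈ classSet₁₃ θ 0 g₀ K, weightA₁₃ θ h.toCore 0 g₀ os K t x)| < s := by
  obtain ⟨β, hβ, hβ', 𝔯, ksel, ℓ, ℓ₃, g, B, hg, hr⟩ := h₁
  obtain ⟨jc, sh, cr, hpin, h20, h21, hx, h19⟩ := h₂ β hβ hβ' 𝔯 ksel ℓ ℓ₃ g B hg hr
  exact lawMerge_of_keyedFacesV β (rrOfRecord 𝔯 ksel) jc sh cr hr hpin h20 h21 hx h19 θ h v hG hθ hB hE hlive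

/-- ★★★ **THE H-LEMMA `stub2_false_of_H` AT K3⁸'s REGISTERED TEXTS** (CRIT-1 triage ed. 2, item 4, kernel form at v6).  H (LS, cofinal, AT A SLOT): SOME Stage-13 tuple `(F, θ, h)`
with SEPARATED provisos passes the guard, is admissible, lies on the live-selector line, and at SOME version slot `v` carries (B) and the endpoint at the slot datum AND there the
record's two across-class laws (at `h.toCore`) are `s`-separated for some `s > 0` NOT eventually excluded along [I] Thm 2's tuned sequences of the slot datum.  THEN the TEXT of
`stub_rates13HV` REFUTES the TEXT of `stub_expansion13HV`.  H is a DISPLAYED HYPOTHESIS — (LS) at the record is UNDECIDED physics and the tuple is inhabited by nobody (K0⁷ OPEN);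
NOT a refutation of the stub and NOT `¬ SpineGivenEndpointR13SepCoPHV`. [bookkeeping] -/
theorem stubTwoTextV_false_of_stubOneTextV_of_lawSeparated
    (hH : ∃ (F : T4Family) (θ : Stage13HParams F 2) (h : θ.Provisos₁₃SepCoPH F 2) (v : Revision₁₃ F 2 θ h),
      (θ.ZhUnity F 2 ∧ θ.SlotsNondegenerate₁₃ F 2) ∧ θ.Admissible F 2 ∧
      B16.EndStatementBPrinted (datumOfRecord₁₃SepCoPHV F 2 θ h v).C ∧ DagBinding.EndpointExistence (datumOfRecord₁₃SepCoPHV F 2 θ h v).C.toB12 ∧ LiveSel F θ ∧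
      ¬ ForSmallCouplings (datumOfRecord₁₃SepCoPHV F 2 θ h v) fun g₀ => ∀ (os : List (ULoop F)) (s : ℝ), 0 < s →
        ¬ ∀ K₁ : ℕ, ∃ K, K₁ ≤ K ∧ ∃ t : ℝ, |t| ≤ 1 ∧ ∃ S, S ⊆ classSet₁₃ θ 0 g₀ K ∧
          s ≤ (∑ x ∈ S, weightB₁₃ θ h.toCore 0 g₀ os K t x) / (∑ x ∈ classSet₁₃ θ 0 g₀ K, weightB₁₃ θ h.toCore 0 g₀ os K t x) -
              (∑ x ∈ S, weightA₁₃ θ h.toCore 0 g₀ os K t x) / (∑ x ∈ classSet₁₃ θ 0 g₀ K, weightA₁₃ θ h.toCore 0 g₀ os K t x))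
    (h₁ : ∃ β : ℝ, 2 / 3 < β ∧ β < 1 ∧ ∃ (𝔯 : RateReading₁₃CoPH 2) (ksel : RunSel) (ℓ : LetterReading) (ℓ₃ : T4Family → Node00.NE3Letters₁₁) (g B : T4Family → ℝ),
      GuardedReadingN16 𝔯 ksel ℓ ℓ₃ g B ∧ KeyedRatesHolderD4V β (rrOfRecord 𝔯 ksel)) :
    ¬ ∀ β : ℝ, 2 / 3 < β → β < 1 → ∀ (𝔯 : RateReading₁₃CoPH 2) (ksel : RunSel) (ℓ : LetterReading) (ℓ₃ : T4Family → Node00.NE3Letters₁₁) (g B : T4Family → ℝ),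
      GuardedReadingN16 𝔯 ksel ℓ ℓ₃ g B → KeyedRatesHolderD4V β (rrOfRecord 𝔯 ksel) →
      ∃ (jc : CutReading) (sh : ShellSplit₁₃CoPH 2 0) (cr : SpineReading), PinnedAtLive jc sh cr ∧
        KeyedRelWeight cr ∧ KeyedShellWeight cr ∧ KeyedExtractionV cr ∧ KeyedCoreEdgeHolderD4V β cr (rrOfRecord 𝔯 ksel) := by
  intro h₂
  obtain ⟨F, θ, h, v, hG, hθ, hB, hE, hlive, hLS⟩ := hH
  exact hLS ((lawMerge_of_stubTextsV h₁ h₂ θ h v hG hθ hB hE hlive).mono fun g₀ hg os s hs hsep =>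
    false_of_lawMerge_of_lawSeparated 0 θ h.toCore g₀ os (hg os s hs) hsep)

/-- ★ **UNDER (LS) AT A SLOT THE v6 SKELETON CANNOT CLOSE AS CUT**: with H as in `stubTwoTextV_false_of_stubOneTextV_of_lawSeparated`, the two registered stub texts are JOINTLY
UNSATISFIABLE.  Says nothing about `SpineGivenEndpointR13SepCoPHV` itself (another skeleton may close it) — hence a flat helper, not a `Negative/` lemma. [bookkeeping] -/
theorem not_stubTextsV_of_lawSeparated
    (hH : ∃ (F : T4Family) (θ : Stage13HParams F 2) (h : θ.Provisos₁₃SepCoPH F 2) (v : Revision₁₃ F 2 θ h),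
      (θ.ZhUnity F 2 ∧ θ.SlotsNondegenerate₁₃ F 2) ∧ θ.Admissible F 2 ∧
      B16.EndStatementBPrinted (datumOfRecord₁₃SepCoPHV F 2 θ h v).C ∧ DagBinding.EndpointExistence (datumOfRecord₁₃SepCoPHV F 2 θ h v).C.toB12 ∧ LiveSel F θ ∧
      ¬ ForSmallCouplings (datumOfRecord₁₃SepCoPHV F 2 θ h v) fun g₀ => ∀ (os : List (ULoop F)) (s : ℝ), 0 < s →
        ¬ ∀ K₁ : ℕ, ∃ K, K₁ ≤ K ∧ ∃ t : ℝ, |t| ≤ 1 ∧ ∃ S, S ⊆ classSet₁₃ θ 0 g₀ K ∧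
          s ≤ (∑ x ∈ S, weightB₁₃ θ h.toCore 0 g₀ os K t x) / (∑ x ∈ classSet₁₃ θ 0 g₀ K, weightB₁₃ θ h.toCore 0 g₀ os K t x) -
              (∑ x ∈ S, weightA₁₃ θ h.toCore 0 g₀ os K t x) / (∑ x ∈ classSet₁₃ θ 0 g₀ K, weightA₁₃ θ h.toCore 0 g₀ os K t x)) :
    ¬ ((∃ β : ℝ, 2 / 3 < β ∧ β < 1 ∧ ∃ (𝔯 : RateReading₁₃CoPH 2) (ksel : RunSel) (ℓ : LetterReading) (ℓ₃ : T4Family → Node00.NE3Letters₁₁) (g B : T4Family → ℝ),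
        GuardedReadingN16 𝔯 ksel ℓ ℓ₃ g B ∧ KeyedRatesHolderD4V β (rrOfRecord 𝔯 ksel)) ∧
      ∀ β : ℝ, 2 / 3 < β → β < 1 → ∀ (𝔯 : RateReading₁₃CoPH 2) (ksel : RunSel) (ℓ : LetterReading) (ℓ₃ : T4Family → Node00.NE3Letters₁₁) (g B : T4Family → ℝ),
        GuardedReadingN16 𝔯 ksel ℓ ℓ₃ g B → KeyedRatesHolderD4V β (rrOfRecord 𝔯 ksel) →
        ∃ (jc : CutReading) (sh : ShellSplit₁₃CoPH 2 0) (cr : SpineReading), PinnedAtLive jc sh cr ∧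
          KeyedRelWeight cr ∧ KeyedShellWeight cr ∧ KeyedExtractionV cr ∧ KeyedCoreEdgeHolderD4V β cr (rrOfRecord 𝔯 ksel)) :=
  fun hh => stubTwoTextV_false_of_stubOneTextV_of_lawSeparated hH hh.1 hh.2

/-- ★★ **THE MASS-CURRENCY H-LEMMA AT THE REGISTERED TEXTS.**  H (Dev, cofinal, AT A SLOT): SOME guarded admissible separated tuple on the live-selector line and SOME slot `v` with
(B)+END at which «some loop string, some `s > 0`, some per-step key map `kmap`: module 13L's run-A deviation at `kmap` is `≥ s·Σ weightA₁₃` for infinitely many `K` at some `|t| ≤ 1`»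
is NOT eventually excluded along the slot datum's tuning.  THEN the TEXT of `stub_rates13HV` refutes the TEXT of `stub_expansion13HV` (§1 ★★ `not_keyedFacesV_of_frequently_fibreDevA_ge`:
13S turns the floor into (LS) with `s∕2`, positivity from the witness's extraction rows).  H is DISPLAYED — a floor NOT PRINTED, NOT measured; regime (b) of 13S (vanishing but
unsummable floors) is NOT covered here (it stays 13Q's binder-list kill). [bookkeeping] -/
theorem stubTwoTextV_false_of_stubOneTextV_of_frequently_fibreDevA_ge
    (hH : ∃ (F : T4Family) (θ : Stage13HParams F 2) (h : θ.Provisos₁₃SepCoPH F 2) (v : Revision₁₃ F 2 θ h),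
      (θ.ZhUnity F 2 ∧ θ.SlotsNondegenerate₁₃ F 2) ∧ θ.Admissible F 2 ∧
      B16.EndStatementBPrinted (datumOfRecord₁₃SepCoPHV F 2 θ h v).C ∧ DagBinding.EndpointExistence (datumOfRecord₁₃SepCoPHV F 2 θ h v).C.toB12 ∧ LiveSel F θ ∧
      ¬ ForSmallCouplings (datumOfRecord₁₃SepCoPHV F 2 θ h v) fun g₀ => ∀ (os : List (ULoop F)) (s : ℝ), 0 < s →
        ∀ kmap : ℕ → (Σ K, SiteSeqKey F (0 + K)) → (Σ K, SiteSeqKey F (0 + K)),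
          ¬ ∀ K₁ : ℕ, ∃ K, K₁ ≤ K ∧ ∃ t : ℝ, |t| ≤ 1 ∧
            s * ∑ x ∈ classSet₁₃ θ 0 g₀ K, weightA₁₃ θ h.toCore 0 g₀ os K t x ≤
              ∑ x ∈ classSet₁₃ θ 0 g₀ K, max 0 (weightA₁₃ θ h.toCore 0 g₀ os K t x -
                weightAK₁₃ θ h.toCore 0 g₀ os kmap K t (kmap K x) / weightBK₁₃ θ h.toCore 0 g₀ os kmap K t (kmap K x) * weightB₁₃ θ h.toCore 0 g₀ os K t x))
    (h₁ : ∃ β : ℝ, 2 / 3 < β ∧ β < 1 ∧ ∃ (𝔯 : RateReading₁₃CoPH 2) (ksel : RunSel) (ℓ : LetterReading) (ℓ₃ : T4Family → Node00.NE3Letters₁₁) (g B : T4Family → ℝ),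
      GuardedReadingN16 𝔯 ksel ℓ ℓ₃ g B ∧ KeyedRatesHolderD4V β (rrOfRecord 𝔯 ksel)) :
    ¬ ∀ β : ℝ, 2 / 3 < β → β < 1 → ∀ (𝔯 : RateReading₁₃CoPH 2) (ksel : RunSel) (ℓ : LetterReading) (ℓ₃ : T4Family → Node00.NE3Letters₁₁) (g B : T4Family → ℝ),
      GuardedReadingN16 𝔯 ksel ℓ ℓ₃ g B → KeyedRatesHolderD4V β (rrOfRecord 𝔯 ksel) →
      ∃ (jc : CutReading) (sh : ShellSplit₁₃CoPH 2 0) (cr : SpineReading), PinnedAtLive jc sh cr ∧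
        KeyedRelWeight cr ∧ KeyedShellWeight cr ∧ KeyedExtractionV cr ∧ KeyedCoreEdgeHolderD4V β cr (rrOfRecord 𝔯 ksel) := by
  intro h₂
  obtain ⟨F, θ, h, v, hG, hθ, hB, hE, hlive, hDev⟩ := hH
  obtain ⟨β, hβ, hβ', 𝔯, ksel, ℓ, ℓ₃, g, B, hg, hr⟩ := h₁
  obtain ⟨jc, sh, cr, hpin, h20, h21, hx, h19⟩ := h₂ β hβ hβ' 𝔯 ksel ℓ ℓ₃ g B hg hr
  exact not_keyedFacesV_of_frequently_fibreDevA_ge β (rrOfRecord 𝔯 ksel) jc sh cr hr hpin θ h v hG hθ hB hE hlive hDev ⟨h20, h21, hx, h19⟩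

end AtTheTexts

/-! ## §2b The EVENTUAL forms of the letters imply the cofinal ones under the endpoint ([I] Thm 2's non-vacuity `ForSmallCouplings.toE` at the SLOT datum) -/

section Eventual

/-- **UNDER THE ENDPOINT, `ForSmallCouplings c` EXCLUDES `ForSmallCouplings ¬c` — AT THE SLOT DATUM** (p610536's lemma was stated at `datumOfRecord₁₃CoPH`; the slot datum is
another `FiniteEpsData`, so the same five lines apply): tuned bare sequences exist for all small `γ`, `g` (`ForSmallCouplings.toE`, [I] Thm 2's non-vacuity). [bookkeeping] -/
theorem not_forSmallCouplings_not_of_forSmallCouplings_slot (θ : Stage13HParams F 2) (h : θ.Provisos₁₃SepCoPH F 2) (v : Revision₁₃ F 2 θ h)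
    (hE : DagBinding.EndpointExistence (datumOfRecord₁₃SepCoPHV F 2 θ h v).C.toB12) {c : (ℕ → ℝ) → Prop}
    (hc : ForSmallCouplings (datumOfRecord₁₃SepCoPHV F 2 θ h v) c) :
    ¬ ForSmallCouplings (datumOfRecord₁₃SepCoPHV F 2 θ h v) fun g₀ => ¬ c g₀ := by
  intro hn
  obtain ⟨γ₀, hγ₀, H⟩ := (hc.and hn).toE hE
  obtain ⟨g₁, hg₁, Hg⟩ := H γ₀ hγ₀ le_rfl
  obtain ⟨g₀, -, hcg, hncg⟩ := Hg g₁ hg₁ le_rfl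
  exact hncg hcg

/-- ★ **THE (LS) H-LEMMA, EVENTUAL EDITION, AT A SLOT**: if at one guarded admissible separated tuple with (B)+END at some slot on the live-selector line the `s`-separation of the
record's laws holds EVENTUALLY in the slot datum's window — `ForSmallCouplings D_v (g₀ ↦ ∃ os s, 0 < s ∧ hsep)` — then the TEXT of `stub_rates13HV` refutes the TEXT of
`stub_expansion13HV` (a stronger letter than §2's cofinal H; displayed, not asserted). [bookkeeping] -/
theorem stubTwoTextV_false_of_stubOneTextV_of_lawSeparated_eventually
    (hH : ∃ (F : T4Family) (θ : Stage13HParams F 2) (h : θ.Provisos₁₃SepCoPH F 2) (v : Revision₁₃ F 2 θ h),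
      (θ.ZhUnity F 2 ∧ θ.SlotsNondegenerate₁₃ F 2) ∧ θ.Admissible F 2 ∧
      B16.EndStatementBPrinted (datumOfRecord₁₃SepCoPHV F 2 θ h v).C ∧ DagBinding.EndpointExistence (datumOfRecord₁₃SepCoPHV F 2 θ h v).C.toB12 ∧ LiveSel F θ ∧
      ForSmallCouplings (datumOfRecord₁₃SepCoPHV F 2 θ h v) fun g₀ => ∃ (os : List (ULoop F)) (s : ℝ), 0 < s ∧
        ∀ K₁ : ℕ, ∃ K, K₁ ≤ K ∧ ∃ t : ℝ, |t| ≤ 1 ∧ ∃ S, S ⊆ classSet₁₃ θ 0 g₀ K ∧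
          s ≤ (∑ x ∈ S, weightB₁₃ θ h.toCore 0 g₀ os K t x) / (∑ x ∈ classSet₁₃ θ 0 g₀ K, weightB₁₃ θ h.toCore 0 g₀ os K t x) -
              (∑ x ∈ S, weightA₁₃ θ h.toCore 0 g₀ os K t x) / (∑ x ∈ classSet₁₃ θ 0 g₀ K, weightA₁₃ θ h.toCore 0 g₀ os K t x))
    (h₁ : ∃ β : ℝ, 2 / 3 < β ∧ β < 1 ∧ ∃ (𝔯 : RateReading₁₃CoPH 2) (ksel : RunSel) (ℓ : LetterReading) (ℓ₃ : T4Family → Node00.NE3Letters₁₁) (g B : T4Family → ℝ),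
      GuardedReadingN16 𝔯 ksel ℓ ℓ₃ g B ∧ KeyedRatesHolderD4V β (rrOfRecord 𝔯 ksel)) :
    ¬ ∀ β : ℝ, 2 / 3 < β → β < 1 → ∀ (𝔯 : RateReading₁₃CoPH 2) (ksel : RunSel) (ℓ : LetterReading) (ℓ₃ : T4Family → Node00.NE3Letters₁₁) (g B : T4Family → ℝ),
      GuardedReadingN16 𝔯 ksel ℓ ℓ₃ g B → KeyedRatesHolderD4V β (rrOfRecord 𝔯 ksel) →
      ∃ (jc : CutReading) (sh : ShellSplit₁₃CoPH 2 0) (cr : SpineReading), PinnedAtLive jc sh cr ∧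
        KeyedRelWeight cr ∧ KeyedShellWeight cr ∧ KeyedExtractionV cr ∧ KeyedCoreEdgeHolderD4V β cr (rrOfRecord 𝔯 ksel) := by
  obtain ⟨F, θ, h, v, hG, hθ, hB, hE, hlive, hev⟩ := hH
  refine stubTwoTextV_false_of_stubOneTextV_of_lawSeparated ⟨F, θ, h, v, hG, hθ, hB, hE, hlive, fun hall => ?_⟩ h₁
  exact not_forSmallCouplings_not_of_forSmallCouplings_slot θ h v hE hev (hall.mono fun g₀ hg ⟨os, s, hs, hsep⟩ => hg os s hs hsep)

/-- ★ **THE (Dev) H-LEMMA, EVENTUAL EDITION, AT A SLOT**: the proportional run-A floor holding EVENTUALLY in the slot datum's window (for all small `γ`, `g`, every tuned `g₀`: some loop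
string, some `s > 0`, some key map with the floor frequently in `K`) ⇒ the TEXT of `stub_rates13HV` refutes the TEXT of `stub_expansion13HV`. [bookkeeping] -/
theorem stubTwoTextV_false_of_stubOneTextV_of_frequently_fibreDevA_ge_eventually
    (hH : ∃ (F : T4Family) (θ : Stage13HParams F 2) (h : θ.Provisos₁₃SepCoPH F 2) (v : Revision₁₃ F 2 θ h),
      (θ.ZhUnity F 2 ∧ θ.SlotsNondegenerate₁₃ F 2) ∧ θ.Admissible F 2 ∧
      B16.EndStatementBPrinted (datumOfRecord₁₃SepCoPHV F 2 θ h v).C ∧ DagBinding.EndpointExistence (datumOfRecord₁₃SepCoPHV F 2 θ h v).C.toB12 ∧ LiveSel F θ ∧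
      ForSmallCouplings (datumOfRecord₁₃SepCoPHV F 2 θ h v) fun g₀ => ∃ (os : List (ULoop F)) (s : ℝ), 0 < s ∧
        ∃ kmap : ℕ → (Σ K, SiteSeqKey F (0 + K)) → (Σ K, SiteSeqKey F (0 + K)),
          ∀ K₁ : ℕ, ∃ K, K₁ ≤ K ∧ ∃ t : ℝ, |t| ≤ 1 ∧
            s * ∑ x ∈ classSet₁₃ θ 0 g₀ K, weightA₁₃ θ h.toCore 0 g₀ os K t x ≤
              ∑ x ∈ classSet₁₃ θ 0 g₀ K, max 0 (weightA₁₃ θ h.toCore 0 g₀ os K t x -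
                weightAK₁₃ θ h.toCore 0 g₀ os kmap K t (kmap K x) / weightBK₁₃ θ h.toCore 0 g₀ os kmap K t (kmap K x) * weightB₁₃ θ h.toCore 0 g₀ os K t x))
    (h₁ : ∃ β : ℝ, 2 / 3 < β ∧ β < 1 ∧ ∃ (𝔯 : RateReading₁₃CoPH 2) (ksel : RunSel) (ℓ : LetterReading) (ℓ₃ : T4Family → Node00.NE3Letters₁₁) (g B : T4Family → ℝ),
      GuardedReadingN16 𝔯 ksel ℓ ℓ₃ g B ∧ KeyedRatesHolderD4V β (rrOfRecord 𝔯 ksel)) :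
    ¬ ∀ β : ℝ, 2 / 3 < β → β < 1 → ∀ (𝔯 : RateReading₁₃CoPH 2) (ksel : RunSel) (ℓ : LetterReading) (ℓ₃ : T4Family → Node00.NE3Letters₁₁) (g B : T4Family → ℝ),
      GuardedReadingN16 𝔯 ksel ℓ ℓ₃ g B → KeyedRatesHolderD4V β (rrOfRecord 𝔯 ksel) →
      ∃ (jc : CutReading) (sh : ShellSplit₁₃CoPH 2 0) (cr : SpineReading), PinnedAtLive jc sh cr ∧
        KeyedRelWeight cr ∧ KeyedShellWeight cr ∧ KeyedExtractionV cr ∧ KeyedCoreEdgeHolderD4V β cr (rrOfRecord 𝔯 ksel) := by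
  obtain ⟨F, θ, h, v, hG, hθ, hB, hE, hlive, hev⟩ := hH
  refine stubTwoTextV_false_of_stubOneTextV_of_frequently_fibreDevA_ge ⟨F, θ, h, v, hG, hθ, hB, hE, hlive, fun hall => ?_⟩ h₁
  exact not_forSmallCouplings_not_of_forSmallCouplings_slot θ h v hE hev (hall.mono fun g₀ hg ⟨os, s, hs, kmap, hfloor⟩ => hg os s hs kmap hfloor)

end Eventual

/-! ## §3 THE DOOR `v := Revision₁₃.refl`: p610536's v5-shaped H at a SEPARATED tuple IS the v6 H at the trivial revision -/

section Door

/-- ★ **THE v5-SHAPED H AT A SEPARATED TUPLE KILLS THE v6 TEXTS.**  If SOME Stage-13 tuple `(F, θ, h)` with SEPARATED provisos passes the guard, is admissible, lies on the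
live-selector line, carries (B) and the endpoint at its v1.7 datum of record `datumOfRecord₁₃SepCoPH F 2 θ h` and there (LS) is NOT eventually excluded along that datum's tuning
(p610536's H, with the provisos separated and the weights at `h.toCore`), then the TEXT of `stub_rates13HV` refutes the TEXT of `stub_expansion13HV` — §2 at `v := Revision₁₃.refl F 2 θ h`,
DEF-1's door `datumOfRecord₁₃SepCoPHV_refl` (`rfl`).  LOCATED: the v6 H is WEAKER than this one — (B) at ANY a.e.-revision of the record's densities opens the door. [bookkeeping] -/
theorem stubTwoTextV_false_of_stubOneTextV_of_lawSeparated_refl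
    (hH : ∃ (F : T4Family) (θ : Stage13HParams F 2) (h : θ.Provisos₁₃SepCoPH F 2),
      (θ.ZhUnity F 2 ∧ θ.SlotsNondegenerate₁₃ F 2) ∧ θ.Admissible F 2 ∧
      B16.EndStatementBPrinted (datumOfRecord₁₃SepCoPH F 2 θ h).C ∧ DagBinding.EndpointExistence (datumOfRecord₁₃SepCoPH F 2 θ h).C.toB12 ∧ LiveSel F θ ∧
      ¬ ForSmallCouplings (datumOfRecord₁₃SepCoPH F 2 θ h) fun g₀ => ∀ (os : List (ULoop F)) (s : ℝ), 0 < s →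
        ¬ ∀ K₁ : ℕ, ∃ K, K₁ ≤ K ∧ ∃ t : ℝ, |t| ≤ 1 ∧ ∃ S, S ⊆ classSet₁₃ θ 0 g₀ K ∧
          s ≤ (∑ x ∈ S, weightB₁₃ θ h.toCore 0 g₀ os K t x) / (∑ x ∈ classSet₁₃ θ 0 g₀ K, weightB₁₃ θ h.toCore 0 g₀ os K t x) -
              (∑ x ∈ S, weightA₁₃ θ h.toCore 0 g₀ os K t x) / (∑ x ∈ classSet₁₃ θ 0 g₀ K, weightA₁₃ θ h.toCore 0 g₀ os K t x))
    (h₁ : ∃ β : ℝ, 2 / 3 < β ∧ β < 1 ∧ ∃ (𝔯 : RateReading₁₃CoPH 2) (ksel : RunSel) (ℓ : LetterReading) (ℓ₃ : T4Family → Node00.NE3Letters₁₁) (g B : T4Family → ℝ),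
      GuardedReadingN16 𝔯 ksel ℓ ℓ₃ g B ∧ KeyedRatesHolderD4V β (rrOfRecord 𝔯 ksel)) :
    ¬ ∀ β : ℝ, 2 / 3 < β → β < 1 → ∀ (𝔯 : RateReading₁₃CoPH 2) (ksel : RunSel) (ℓ : LetterReading) (ℓ₃ : T4Family → Node00.NE3Letters₁₁) (g B : T4Family → ℝ),
      GuardedReadingN16 𝔯 ksel ℓ ℓ₃ g B → KeyedRatesHolderD4V β (rrOfRecord 𝔯 ksel) →
      ∃ (jc : CutReading) (sh : ShellSplit₁₃CoPH 2 0) (cr : SpineReading), PinnedAtLive jc sh cr ∧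
        KeyedRelWeight cr ∧ KeyedShellWeight cr ∧ KeyedExtractionV cr ∧ KeyedCoreEdgeHolderD4V β cr (rrOfRecord 𝔯 ksel) := by
  obtain ⟨F, θ, h, hG, hθ, hB, hE, hlive, hLS⟩ := hH
  exact stubTwoTextV_false_of_stubOneTextV_of_lawSeparated ⟨F, θ, h, Revision₁₃.refl F 2 θ h, hG, hθ, hB, hE, hlive, hLS⟩ h₁

end Door

end Summit.QuantumFields.YangMills.BalabanUVNodes.N20StubTwoTextVFalseOfLawSeparated

end
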